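import Literature.MathematicalPhysics.QuantumFieldTheory.Balaban1983to89.B1Ineq225ZeroFieldTorusLevels

/-!
# `Balaban1983to89.B1Ineq367SmallFieldTorus` — T. Bałaban, *(Higgs)₂,₃ quantum fields in a finite volume. I. A lower bound*, Commun. Math.
# Phys. **85** (1982) 603–626 [Balaban1982Higgs1]: the replacement **(3.67)** p. 625 (`χ_K(A)χ_K(φ) = 1` on the small-field set — the
# displayed input (E3) `hE3` of `B1LowerBound114Model.Inputs`) FOR THE CONCRETE MODEL ON THE TORUS SUB-FAMILY, with the VECTOR-FIELD
# HALF of its (2.25)-shaped input DISCHARGED (Prop. 2.1 at `A = 0` on the torus, `B1Ineq225ZeroFieldTorusLevels.propagatorK_sup_bound_at`):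
# only the scalar half `hGs` (the propagator `G^ε_K(A^{(K),ε})` at a regular background field `A ≠ 0`) remains displayed

statement-level skeleton of published theorems with citation tags; proofs where landed; nothing here is a claim about the Yang–Mills mass gap

PDF held: `paper:balaban1982-cmp85-higgs23-i` (journal page = PDF page + 602), p. 625 [PDF 23] ((3.67)), p. 617 [PDF 15] ((3.27)–(3.29)),
p. 610 [PDF 8] (Prop. 2.1 (2.25)); read by this seat (materialised `~/.lit/texts/paper-balaban1982-cmp85-higgs23-i/`).

CITATION HEADER (lean-in-tree rule).  Cell `lit-balaban` (HOME `run/shared/lean/pub/lit-balaban/`), Phase-2 proof seat **p14** gen 10 (unit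
`lit-balaban-p14`); SKELETON rows **B1.Thm@606** (model ledger `B1LowerBound114Model.Inputs`, field `hE3`) and **B1.Eq3.66**/(3.67) (owners
r14/r12).  A KNIT of two accepted files of this seat's lineage, no new mathematics: gen 8's `B1Ineq367SmallField.chiW_eq_one_of_smallSet`
((E3) at `K ≥ 1` GIVEN the two sup bounds `hGv` — `G^ε_K` at `A = 0`, mass `μ₀²` — and `hGs` — `G^ε_K(A^{(K),ε})`, mass `m²`) and gen 9's
`B1Ineq225ZeroFieldTorusLevels.propagatorK_sup_bound_at` (the sup bound for `G^ε_k(T_ε, 0)` at every level on the torus sub-family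
`B1Eq211ZeroFieldTorus.Shape`, every coupling — here the zero charge, `N = d`).  USED BY NAME, never restated: those two, `B1Ineq367SmallField.c₁_choice`,
`B1Ineq326HiggsModel.chiW`, `B1Ineq368BoxBound.smallSet`, `B1Eq31Concrete.{thrF, bgVec}`, `B3MultiscaleFields.{toSite, zeroCharge}`.

WHAT IS PRINTED (verbatim, I p. 625 [PDF 23]).  *"Further we can estimate χ_K(A)χ_K(φ) ≧ Π_{x∈T^{(K)}_{L^Kε}} χ({|A(x)| ≦
c₁⁻¹(L^Kε)^{−(d−2)/2}p(L^Kε)})·χ({|φ(x)| ≦ c₁⁻¹(L^Kε)^{−(d−2)/2}p(L^Kε)}) (3.67)"*; p. 617 [PDF 15] (3.27)–(3.29): the restrictions `χ_k(A)`,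
`χ_k(φ)` on the background fields `A^{(k),ε} = a_k(L^kε)^{−2}G^ε_kQ_k^*A`, `φ^{(k),ε} = a_k(L^kε)^{−2}G^ε_k(A^{(k),ε})Q_k^*(A^{(k),ε})φ`; p. 610 [PDF 8]
(2.25): *"|(D^η_{A}G_k(Ω,A)f)(x)|, |(G_k(Ω,A)f)(x)| ≦ c₀ exp(−δ₀ dist(x, supp f)) sup_{x′}|f(x′)|"*.

WHAT THIS FILE PROVES (kernel-checked, zero `sorry`, theorems only; axioms standard).
* **`chiW_eq_one_of_smallSet_torus_at`** — (E3) AT `K ≥ 1` ON THE TORUS SUB-FAMILY WITH ONLY THE SCALAR HALF DISPLAYED: for `d ≥ 1`, odd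
  `L > 1`, `a > 0`, `μ₀² > 0`, `m² > 0`, any `ε₀` there is `c_v > 0` (the zero-field constant of `propagatorK_sup_bound_at`) such that for every
  torus of the sub-family, every `N` and charge data, every `1 ≤ K ≤ K_P` with `L^Kε ≤ ε₀`, every `c₀ ≥ c_v` and `c₁ > 0` satisfying the two
  printed-shape constraints `a_K(c₀ + 1 + μ₀²c₀(L^Kε)² + a_Kc₀) ≤ c₁`, `a_K(c₀ + 1 + m²c₀(L^Kε)² + a_Kc₀) ≤ c₁`, thresholds `ℓ_K = L^Kε`, `p_K`,
  radius `r ≤ c₁⁻¹(L^Kε)^{−(d−2)/2}p_K`: IF the scalar propagators `G^ε_K(A^{(K),ε})` (`|A| ≤ r`) obey `‖G g‖_∞ ≤ c₀(L^Kε)²‖g‖_∞` (`hGs`),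
  THEN `χ_K(A)χ_K(φ) = 1` on `S_r` — `chiW_eq_one_of_smallSet` with `hGv` supplied.
* **`chiW_eq_one_of_smallSet_torus_unif`** — the same with the `K, ε`-free `c₁ = a(c₀ + 1 + (μ₀² + m²)c₀ + ac₀)` of `c₁_choice` (`L^Kε ≤ 1`).
HONEST SCOPE.  The scalar half `hGs` (Prop. 2.1 (2.25) for `G^ε_K(T_ε, A^{(K),ε})`, `A ≠ 0` regular) stays a displayed hypothesis — it is not
in the tree on the torus; tori of the sub-family `Shape` only (`M·L′_μ = L^m`, `L` odd); `K ≥ 1` (the case `K = 0` is gen 8's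
`chiW_zero_eq_one_of_smallSet`, hypothesis-free); nothing here is summit progress.
-/

open scoped BigOperators

namespace Literature.MathematicalPhysics.QuantumFieldTheory.Balaban1983to89.B1Ineq367SmallFieldTorus

open Literature.MathematicalPhysics.QuantumFieldTheory.Balaban1983to89.HiggsLattice (ChargeData)
open Literature.MathematicalPhysics.QuantumFieldTheory.Balaban1983to89.HiggsCovariance (propagatorK)
open Literature.MathematicalPhysics.QuantumFieldTheory.Balaban1983to89.B3MultiscaleFields (zeroCharge toSite)
open Literature.MathematicalPhysics.QuantumFieldTheory.Balaban1983to89.B1Eq31Concrete (thrF bgVec)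
open Literature.MathematicalPhysics.QuantumFieldTheory.Balaban1983to89.B1Ineq326HiggsModel (chiW)
open Literature.MathematicalPhysics.QuantumFieldTheory.Balaban1983to89.B1Ineq368BoxBound (smallSet)
open Literature.MathematicalPhysics.QuantumFieldTheory.Balaban1983to89.B1Eq211ZeroFieldTorus (Shape)
open Literature.MathematicalPhysics.QuantumFieldTheory.Balaban1983to89.B1Ineq225ZeroFieldTorusLevels (propagatorK_sup_bound_at)
open Literature.MathematicalPhysics.QuantumFieldTheory.Balaban1983to89.B1Ineq367SmallField (chiW_eq_one_of_smallSet c₁_choice)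

/-- **(3.67)/(E3) AT `K ≥ 1` ON THE TORUS SUB-FAMILY, VECTOR HALF DISCHARGED**: with the zero-field constant `c_v` of Prop. 2.1 (2.25) on the
torus (`propagatorK_sup_bound_at`, every level), for every `c₀ ≥ c_v` for which the SCALAR propagators `G^ε_K(A^{(K),ε})` (`|A(x)| ≤ r`) obey
the (2.25)-shaped sup bound `hGs`, and every `c₁` above the two printed-shape constants, `χ_K(A)χ_K(φ) = 1` on the small-field set
`S_r`, `r ≤ c₁⁻¹(L^Kε)^{−(d−2)/2}p_K`. [cite: Balaban1982Higgs1, (3.67) p.625; (3.27)–(3.29) p.617; Prop. 2.1 (2.25) p.610] -/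
theorem chiW_eq_one_of_smallSet_torus_at (d L : ℕ) (hd : 1 ≤ d) (hL : Odd L ∧ 1 < L) {a : ℝ} (ha : 0 < a)
    {mu0sq msq : ℝ} (hmu : 0 < mu0sq) (hmsq : 0 < msq) (ε₀ : ℝ) :
    ∃ cv : ℝ, 0 < cv ∧ ∀ (P : HiggsLattice.Params) (_S : Shape P), P.d = d → P.L = L →
      ∀ {N : ℕ} (C : ChargeData N) {K : ℕ}, 1 ≤ K → K ≤ P.K → P.mesh K ≤ ε₀ →
      ∀ {c₀ : ℝ}, cv ≤ c₀ → ∀ {c₁ : ℝ}, 0 < c₁ →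
        B1.aSeq a P.L K * (c₀ + 1 + mu0sq * c₀ * P.mesh K ^ 2 + B1.aSeq a P.L K * c₀) ≤ c₁ →
        B1.aSeq a P.L K * (c₀ + 1 + msq * c₀ * P.mesh K ^ 2 + B1.aSeq a P.L K * c₀) ≤ c₁ →
      ∀ (ℓ p : ℕ → ℝ), ℓ K = P.mesh K → ∀ {r : ℝ}, r ≤ c₁⁻¹ * thrF P.d (P.mesh K) (p K) →
        (∀ A : HiggsLattice.VecField P K, (∀ x, ‖toSite A x‖ ≤ r) →
            ∀ (g : HiggsLattice.ScalarField P 0 N) (M : ℝ), (∀ x, ‖g x‖ ≤ M) →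
              ∀ x, ‖propagatorK C Finset.univ (bgVec mu0sq a K A) msq a K g x‖ ≤ c₀ * P.mesh K ^ 2 * M) →
        ∀ ω ∈ smallSet P N K r, chiW C ℓ p mu0sq msq a K ω.1 ω.2 = 1 := by
  obtain ⟨cv, hcv, hGv⟩ := propagatorK_sup_bound_at d L d hd hL ha hmu.le ε₀
  refine ⟨cv, hcv, fun P S hPd hPL N C K hK1 hK hε c₀ hc₀ c₁ hc₁0 hc₁v hc₁s ℓ p hℓK r hr hGs => ?_⟩
  have hL1 : (1 : ℝ) < P.L := by rw [hPL]; exact_mod_cast hL.2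
  subst hPd
  refine chiW_eq_one_of_smallSet C ℓ p hK1 hK hmu hmsq (B1.aSeq_pos ha hL1 hK1).le (hcv.le.trans hc₀) hc₁0 hc₁v hc₁s
    hℓK hr ?_ hGs
  intro g M hg x
  have h := hGv P S rfl hPL (zeroCharge P.d) hK1 hK hε g M hg x
  have hM : 0 ≤ M := (norm_nonneg _).trans (hg x)
  exact h.trans (mul_le_mul_of_nonneg_right (mul_le_mul_of_nonneg_right hc₀ (sq_nonneg _)) hM)

/-- **(3.67)/(E3) AT `K ≥ 1` ON THE TORUS SUB-FAMILY with the `K, ε`-FREE constant `c₁ = a(c₀ + 1 + (μ₀² + m²)c₀ + ac₀)`** (p. 621/625: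
the constants do not depend on `k, ε`; `B1Ineq367SmallField.c₁_choice`, using `a_K ≤ a` (2.15) and `L^Kε ≤ 1`): only the scalar sup bound `hGs`
is displayed. [cite: Balaban1982Higgs1, (3.67) p.625; (2.15) p.609; Prop. 2.1 (2.25) p.610] -/
theorem chiW_eq_one_of_smallSet_torus_unif (d L : ℕ) (hd : 1 ≤ d) (hL : Odd L ∧ 1 < L) {a : ℝ} (ha : 0 < a)
    {mu0sq msq : ℝ} (hmu : 0 < mu0sq) (hmsq : 0 < msq) (ε₀ : ℝ) :
    ∃ cv : ℝ, 0 < cv ∧ ∀ (P : HiggsLattice.Params) (_S : Shape P), P.d = d → P.L = L →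
      ∀ {N : ℕ} (C : ChargeData N) {K : ℕ}, 1 ≤ K → K ≤ P.K → P.mesh K ≤ ε₀ → P.mesh K ≤ 1 →
      ∀ {c₀ : ℝ}, cv ≤ c₀ →
      ∀ (ℓ p : ℕ → ℝ), ℓ K = P.mesh K →
        ∀ {r : ℝ}, r ≤ (a * (c₀ + 1 + (mu0sq + msq) * c₀ + a * c₀))⁻¹ * thrF P.d (P.mesh K) (p K) →
        (∀ A : HiggsLattice.VecField P K, (∀ x, ‖toSite A x‖ ≤ r) →
            ∀ (g : HiggsLattice.ScalarField P 0 N) (M : ℝ), (∀ x, ‖g x‖ ≤ M) →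
              ∀ x, ‖propagatorK C Finset.univ (bgVec mu0sq a K A) msq a K g x‖ ≤ c₀ * P.mesh K ^ 2 * M) →
        ∀ ω ∈ smallSet P N K r, chiW C ℓ p mu0sq msq a K ω.1 ω.2 = 1 := by
  obtain ⟨cv, hcv, h⟩ := chiW_eq_one_of_smallSet_torus_at d L hd hL ha hmu hmsq ε₀
  refine ⟨cv, hcv, fun P S hPd hPL N C K hK1 hK hε hε1 c₀ hc₀ ℓ p hℓK r hr hGs => ?_⟩
  have hL1 : (1 : ℝ) < P.L := by rw [hPL]; exact_mod_cast hL.2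
  have hc₀0 : 0 ≤ c₀ := hcv.le.trans hc₀
  have hc := c₁_choice (P := P) (mu0sq := mu0sq) (msq := msq) (c₀ := c₀) hK1 hL1 ha hmu.le hmsq.le hc₀0 hε1
  have hc₁0 : 0 < a * (c₀ + 1 + (mu0sq + msq) * c₀ + a * c₀) := by
    have : 1 ≤ c₀ + 1 + (mu0sq + msq) * c₀ + a * c₀ := by nlinarith [hmu.le, hmsq.le, ha.le]
    positivity
  exact h P S hPd hPL C hK1 hK hε hc₀ hc₁0 hc.1 hc.2 ℓ p hℓK hr hGs

end Literature.MathematicalPhysics.QuantumFieldTheory.Balaban1983to89.B1Ineq367SmallFieldTorus
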